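import Summits.Ventures.HodgeRepro2.HeckeCompositionNormalizerRight
import Summits.Ventures.HodgeRepro2.HeckeFamilyComposition
import Summits.Ventures.HodgeRepro2.DoubleCosetMem

/-!
# HeckeCommuteNormalizer — when a Hecke operator commutes with a normalising (Atkin–Lehner) element, and the
resulting `±`-decomposition of its eigenforms (p2 annex row 159)

Cell pub-hodge-repro2, Tier 5 kernel annex (seat p2, Shimura-data / Hecke side). Proof lane (no new definition).
§8(d): uses an L-value-free non-vanishing device: NO.

* `doubleCoset_mul_eq_of_conj_mem` — for `β` normalising `S` and `β α β⁻¹ ∈ S α S`: `S βα S = S αβ S`.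
* `hecke_comm_of_normalizes_of_doubleCoset_eq` — `T_α (T_β f) = T_β (T_α f)` on the ball whenever
  `S βα S = S αβ S` (rows 156 + 158 give `T_{βα} f` and `T_{αβ} f`; row 137's `hecke_eq_of_doubleCoset_eq`
  identifies them).
* `heckeFamilyOf_heckeFamilyOf_eq_of_normalizes'` — row 158's `T_β (T_α v) = T_{αβ} v` on the Petersson space.
* `heckeFamilyOf_comm_of_normalizes_of_doubleCoset_eq` — the commutation on the Petersson space.
* `exists_atkinLehner_split` — for a normalising involution `w` with `w α w⁻¹ ∈ S α S`, every `T_α`-eigenvector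
  `v` (eigenvalue `μ`) is `½ (vp + vm)` with `vp`, `vm` `T_α`-eigenvectors of the same eigenvalue `μ` and
  `T_w vp = vp`, `T_w vm = −vm` (row 157's Atkin–Lehner decomposition, its commutation hypothesis discharged).

No `sorry`; `#print axioms` ⊆ {propext, Classical.choice, Quot.sound}.
-/

namespace Summit.Ventures.HodgeRepro2.ShimuraData

variable {K : Type*} [Field K]

/-- For `β` normalising `S` and `β α β⁻¹ ∈ S α S` we have `βα ∈ S αβ S`, hence `S βα S = S αβ S`. -/
theorem doubleCoset_mul_eq_of_conj_mem {S : Subgroup (GL (Fin 3) K)} {β α : GL (Fin 3) K}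
    (hβ : ∀ s : GL (Fin 3) K, s ∈ S ↔ β * s * β⁻¹ ∈ S) (hconj : β * α * β⁻¹ ∈ doubleCoset S α) :
    doubleCoset S (β * α) = doubleCoset S (α * β) := by
  apply doubleCoset_eq_of_mem
  obtain ⟨s₁, hs₁, s₂, hs₂, h⟩ := hconj
  -- `β α = (β α β⁻¹) β = s₁ α s₂ β = s₁ (α β) (β⁻¹ s₂ β)` with `β⁻¹ s₂ β ∈ S`.
  have hs₂' : β⁻¹ * s₂ * β ∈ S := by
    rw [hβ]
    simpa [mul_assoc] using hs₂
  refine ⟨s₁, hs₁, β⁻¹ * s₂ * β, hs₂', ?_⟩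
  have : β * α = s₁ * α * s₂ * β := by
    rw [← h]; group
  rw [this]; group

variable [NumberField K] [NumberField.IsCMField K] {τ₁ : K →+* ℂ} {H : Matrix (Fin 3) (Fin 3) K}
  {Q : Matrix (Fin 3) (Fin 3) ℂ}

/-- `T_α (T_β f) = T_β (T_α f)` on the ball for `β ∈ U(H)(K)` normalising `S`, `α ∈ U(H)(K)`, and
`S βα S = S αβ S`: both sides are `T_{βα} f = T_{αβ} f` (rows 156, 158, 137). -/
theorem hecke_comm_of_normalizes_of_doubleCoset_eq (hQ : IsFrame K τ₁ H Q) {S : Subgroup (GL (Fin 3) K)}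
    (hS : (S : Set (GL (Fin 3) K)) ⊆ unitaryGroup K H) {β α : GL (Fin 3) K}
    (hβ : ∀ s : GL (Fin 3) K, s ∈ S ↔ β * s * β⁻¹ ∈ S) (hβU : β ∈ unitaryGroup K H)
    (hαU : α ∈ unitaryGroup K H) (hdc : doubleCoset S (β * α) = doubleCoset S (α * β))
    [Fintype (S ⧸ (heckeSubgroup S α).subgroupOf S)] [Fintype (S ⧸ (heckeSubgroup S β).subgroupOf S)]
    [Fintype (S ⧸ (heckeSubgroup S (β * α)).subgroupOf S)]
    [Fintype (S ⧸ (heckeSubgroup S (α * β)).subgroupOf S)] {k : ℕ} {f : (Fin 2 → ℂ) → ℂ}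
    (hf : IsWeightFor τ₁ Q S k f) {z : Fin 2 → ℂ} (hz : z ∈ ball₂) :
    hecke S α τ₁ Q k (hecke S β τ₁ Q k f) z = hecke S β τ₁ Q k (hecke S α τ₁ Q k f) z := by
  rw [hecke_hecke_eq_hecke_mul_of_normalizes hQ hS hβ hβU hαU hf hz,
    hecke_hecke_eq_hecke_mul_of_normalizes' hQ hS hβ hβU hαU hf hz]
  exact hecke_eq_of_doubleCoset_eq hQ hS (S := S) (mul_mem hαU hβU) hdc hf hz

section PeterssonSpace

variable (hQ : IsFrame K τ₁ H Q) (S : Subgroup (GL (Fin 3) K)) (hS : (S : Set (GL (Fin 3) K)) ⊆ unitaryGroup K H)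
  [CompactSpace (ballQuotient hQ S hS)] {D : Set ball₂} (k : ℕ) (hD : IsBallFundamentalDomain hQ S hS D)
  (hDm : MeasurableSet D)
  (inst : ∀ δ : unitaryGroup K H, Fintype (S ⧸ (heckeSubgroup S (δ : GL (Fin 3) K)).subgroupOf S))

/-- `T_β (T_α v) = T_{αβ} v` on the Petersson space, for `β ∈ U(H)(K)` normalising `S` and any `α ∈ U(H)(K)`
(row 158's `hecke_hecke_eq_hecke_mul_of_normalizes'` descended through `PeterssonSpace.mk_eq_mk_iff`). -/
theorem heckeFamilyOf_heckeFamilyOf_eq_of_normalizes' {β α : unitaryGroup K H}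
    (hβ : ∀ s : GL (Fin 3) K, s ∈ S ↔ (β : GL (Fin 3) K) * s * (β : GL (Fin 3) K)⁻¹ ∈ S)
    (v : PeterssonSpace hQ S hS k hD) :
    heckeFamilyOf hQ S hS k hD hDm inst β (heckeFamilyOf hQ S hS k hD hDm inst α v) =
      heckeFamilyOf hQ S hS k hD hDm inst (α * β) v := by
  obtain ⟨f, rfl⟩ := SeparationQuotient.surjective_mk v
  rw [heckeFamilyOf_mk, heckeFamilyOf_mk, heckeFamilyOf_mk, PeterssonSpace.mk_eq_mk_iff]
  intro z hz
  have hf : IsWeightFor τ₁ Q S k ((PeterssonForms.toForm hQ S hS k hD f : (Fin 2 → ℂ) → ℂ)) :=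
    ((mem_weightForms τ₁ Q S k).mp (PeterssonForms.toForm hQ S hS k hD f).2).1
  simp only [heckeForms_apply_coe]
  exact @hecke_hecke_eq_hecke_mul_of_normalizes' _ _ _ _ _ _ _ hQ S hS β α hβ β.2 α.2 (inst α) (inst β)
    (inst (α * β)) k _ hf z hz

/-- `T_α` and `T_β` commute on the Petersson space when `β` normalises `S` and `S βα S = S αβ S`. -/
theorem heckeFamilyOf_comm_of_normalizes_of_doubleCoset_eq {β α : unitaryGroup K H}
    (hβ : ∀ s : GL (Fin 3) K, s ∈ S ↔ (β : GL (Fin 3) K) * s * (β : GL (Fin 3) K)⁻¹ ∈ S)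
    (hdc : doubleCoset S ((β : GL (Fin 3) K) * α) = doubleCoset S ((α : GL (Fin 3) K) * β))
    (v : PeterssonSpace hQ S hS k hD) :
    heckeFamilyOf hQ S hS k hD hDm inst α (heckeFamilyOf hQ S hS k hD hDm inst β v) =
      heckeFamilyOf hQ S hS k hD hDm inst β (heckeFamilyOf hQ S hS k hD hDm inst α v) := by
  rw [heckeFamilyOf_heckeFamilyOf_eq_of_normalizes hQ S hS k hD hDm inst hβ v,
    heckeFamilyOf_heckeFamilyOf_eq_of_normalizes' hQ S hS k hD hDm inst hβ v]
  exact congrFun (congrArg DFunLike.coe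
    (heckeFamilyOf_eq_of_doubleCoset_eq hQ S hS k hD hDm inst (δ := β * α) (δ' := α * β) hdc)) v

/-- THE ATKIN–LEHNER SPLITTING OF A HECKE EIGENFORM. For a normalising involution `w ∈ U(H)(K)` with
`w α w⁻¹ ∈ S α S` (so `T_w` commutes with `T_α`), every `T_α`-eigenvector `v` of eigenvalue `μ` is
`v = ½ (vp + vm)` with `vp`, `vm` `T_α`-eigenvectors of the same eigenvalue `μ` and `T_w vp = vp`,
`T_w vm = −vm` (`vp = v + T_w v`, `vm = v − T_w v`). -/
theorem exists_atkinLehner_split {w α : unitaryGroup K H}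
    (hw : ∀ s : GL (Fin 3) K, s ∈ S ↔ (w : GL (Fin 3) K) * s * (w : GL (Fin 3) K)⁻¹ ∈ S)
    (hw2 : (w : GL (Fin 3) K) * w = 1)
    (hconj : (w : GL (Fin 3) K) * α * (w : GL (Fin 3) K)⁻¹ ∈ doubleCoset S α)
    {v : PeterssonSpace hQ S hS k hD} {μ : ℂ} (hv : heckeFamilyOf hQ S hS k hD hDm inst α v = μ • v) :
    ∃ vp vm : PeterssonSpace hQ S hS k hD, v = (2 : ℂ)⁻¹ • (vp + vm) ∧
      heckeFamilyOf hQ S hS k hD hDm inst w vp = vp ∧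
      heckeFamilyOf hQ S hS k hD hDm inst w vm = -vm ∧
      heckeFamilyOf hQ S hS k hD hDm inst α vp = μ • vp ∧
      heckeFamilyOf hQ S hS k hD hDm inst α vm = μ • vm := by
  have hcomm : heckeFamilyOf hQ S hS k hD hDm inst α (heckeFamilyOf hQ S hS k hD hDm inst w v) =
      heckeFamilyOf hQ S hS k hD hDm inst w (heckeFamilyOf hQ S hS k hD hDm inst α v) :=
    heckeFamilyOf_comm_of_normalizes_of_doubleCoset_eq hQ S hS k hD hDm inst hw
      (doubleCoset_mul_eq_of_conj_mem hw hconj) v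
  obtain ⟨h₁, h₂, h₃, h₄, h₅⟩ :=
    eigenvector_split_of_normalizes_of_sq_eq_one hQ S hS k hD hDm inst hw hw2 hv hcomm
  exact ⟨v + heckeFamilyOf hQ S hS k hD hDm inst w v, v - heckeFamilyOf hQ S hS k hD hDm inst w v,
    h₅.symm, h₁, h₂, h₃, h₄⟩

end PeterssonSpace

end Summit.Ventures.HodgeRepro2.ShimuraData
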